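import Summits.QuantumFields.YangMills.Theorems.PoincareLipschitzGradientLimitPotentialLetters
import Literature.Analysis.FunctionSpaces.SobolevDomainProofs
import HarnessLib

/-!
# Potentials of `L²`-limits of gradients of `C¹` maps (closure of gradients, `Ḣ¹`-completeness)

Helper file (K2 lane of crux `stmt-QuantumFields-19936` `HistoryTailL`, LINE 25 «CompactnessTransfer»,
the (TM)-discharge road «SU(2) currents ⇒ H-system ⇒ 8π quantum», brick (H) «planar stream
function», seam letter (H-lim)).  YM₃ on the unit 3-torus is rung R3 of the ladder — NOT `d = 4`,
NOT infinite volume, NOT a mass gap, NOT the Clay problem; nothing here bears on those.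

Pure analysis, generic in the dimension.  Let `E` be a finite-dimensional real normed space with an
additive Haar measure `μ`, `F` a complete real normed space, and `u n : E → F` (`n : ℕ`) maps of
class `C¹` whose derivatives `fderiv ℝ (u n)` converge **in `L²(μ)` on the whole space** to some
a.e.-strongly measurable `G : E → E →L[ℝ] F`.  Then (`exists_potential_of_tendsto_fderiv`) there is
`B : E → F`, locally integrable, with

* `HasWeakFDerivOn ⟨univ, isOpen_univ⟩ μ B G` — `G` is the weak derivative of `B` on all of `E`;
* for every radius `R`, `u n − ⨍_{B(0,1)} u n → B` in `L²(μ|B(0,R))`.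

This is the completeness of the homogeneous Sobolev space `Ḣ¹` modulo constants / the closedness of
the space of `L²` gradients (Maz'ya, *Sobolev Spaces* (1985), §1.1.13, Thm. 1 and its Corollary;
Deny–Lions 1954), proved from the letters file (`…GradientLimitPotentialLetters`: Poincaré with the
unit-ball mean, fast subsequences, pairings under `L²_loc` convergence) and Mathlib's `L^p` Cauchy
machinery: the normalised maps `u n − ⨍_{B(0,1)} u n` are Cauchy in every `L²(B(0,R))` at the rate
`K_R ‖D(u n) − G‖_{L²(μ)}`; along ONE fast subsequence Mathlib's `ae_tendsto_of_cauchy_eLpNorm` gives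
an a.e. limit on every ball `B(0,N)`, hence on `E` (no gluing over radii); Fatou
(`eLpNorm_lim_le_liminf_eLpNorm`) gives the convergence of the full sequence; integration by parts
for `C¹` maps (`Literature.Analysis.FunctionSpaces.HasWeakFDerivOn.of_contDiff_holds`) passes to the
limit in both pairings.

No curl / divergence / stream-function / mollifier letters occur here: the file is the seam that
turns «smooth potentials with `L²`-convergent gradients» into «one weak potential on the whole
space», as used by brick (H) after mollification and the Poincaré lemma.

References: V. G. Maz'ya, *Sobolev Spaces* (1985), §1.1.13; J. Deny, J.-L. Lions, *Les espaces du
type de Beppo Levi*, Ann. Inst. Fourier 5 (1954) 305–370; L. C. Evans, *PDE* (2010), §5.8.1.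
-/

noncomputable section

open MeasureTheory Set Filter Metric TopologicalSpace Module
open scoped ENNReal NNReal Topology

namespace Summit.QuantumFields.YangMills.Theorems.PoincareLipschitzGradientLimitPotential

open Literature.Analysis.FunctionSpaces

variable {E : Type*} [NormedAddCommGroup E] [NormedSpace ℝ E] [FiniteDimensional ℝ E]
  [MeasurableSpace E] [BorelSpace E]
variable {F : Type*} [NormedAddCommGroup F] [NormedSpace ℝ F] [CompleteSpace F]
variable (μ : Measure E) [μ.IsAddHaarMeasure]

/-! ## §3 The potential of an `L²`-limit of gradients -/

/-- **Potentials of `L²`-limits of gradients of `C¹` maps.**  Let `u n : E → F` be `C¹` maps on a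
finite-dimensional real normed space `E` (additive Haar measure `μ`, `F` complete) whose derivatives
converge in `L²(μ)` to an a.e.-strongly measurable `G`:  `‖D(u n) − G‖_{L²(μ)} → 0`.  Then there is a
locally integrable `B : E → F` with weak derivative `G` on the whole space,
`HasWeakFDerivOn ⟨univ, isOpen_univ⟩ μ B G`, and `u n − ⨍_{B(0,1)} u n → B` in `L²(μ|B(0,R))` for every
radius `R` (completeness of `Ḣ¹` modulo constants: Maz'ya, *Sobolev Spaces*, §1.1.13; Deny–Lions
1954).  Proof: §1's Poincaré inequality with the unit-ball mean makes the normalised maps Cauchy in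
every `L²(B(0,R))`; an a.e. limit along a fast subsequence (Mathlib's `ae_tendsto_of_cauchy_eLpNorm`
on the balls `B(0,N)`, `N ∈ ℕ`), Fatou for the full sequence, and §2's pairing lemma on both sides of
the integration-by-parts identity of the `C¹` maps. [cite: Mazja1985, §1.1.13 Thm. 1] -/
theorem exists_potential_of_tendsto_fderiv (u : ℕ → E → F) (hu : ∀ n, ContDiff ℝ 1 (u n))
    {G : E → E →L[ℝ] F} (hGm : AEStronglyMeasurable G μ)
    (hlim : Tendsto (fun n => eLpNorm (fderiv ℝ (u n) - G) 2 μ) atTop (𝓝 0)) :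
    ∃ B : E → F, HasWeakFDerivOn ⟨univ, isOpen_univ⟩ μ B G ∧
      ∀ R : ℝ, Tendsto (fun n => eLpNorm (fun x => u n x - (⨍ y in ball (0 : E) 1, u n y ∂μ) - B x) 2
        (μ.restrict (ball 0 R))) atTop (𝓝 0) := by
  -- notation: the normalised maps `w n` and the rates `δ n`
  set w : ℕ → E → F := fun n x => u n x - ⨍ y in ball (0 : E) 1, u n y ∂μ with hw
  set δ : ℕ → ℝ≥0∞ := fun n => eLpNorm (fderiv ℝ (u n) - G) 2 μ with hδ
  have hwC : ∀ n, ContDiff ℝ 1 (w n) := fun n => (hu n).sub contDiff_const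
  have hwm : ∀ n (ν : Measure E), AEStronglyMeasurable (w n) ν := fun n ν =>
    (hwC n).continuous.aestronglyMeasurable
  have hfdw : ∀ n, fderiv ℝ (w n) = fderiv ℝ (u n) := by
    intro n; funext x; rw [hw]; exact fderiv_sub_const _
  have hDm : ∀ n, AEStronglyMeasurable (fderiv ℝ (u n) - G) μ := fun n =>
    ((hu n).continuous_fderiv one_ne_zero).aestronglyMeasurable.sub hGm
  -- (1) the Cauchy estimate on balls
  have hcauchy : ∀ R : ℝ, ∃ K : ℝ≥0∞, K ≠ ⊤ ∧ ∀ n m,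
      eLpNorm (w n - w m) 2 (μ.restrict (ball 0 R)) ≤ K * (δ n + δ m) := by
    intro R
    obtain ⟨K, hKt, hK⟩ := exists_eLpNorm_sub_unitBallAverage_le μ (F := F) R
    refine ⟨K, hKt, fun n m => ?_⟩
    have hGd : ContDiff ℝ 1 (fun x => u n x - u m x) := (hu n).sub (hu m)
    have hav : ⨍ y in ball (0 : E) 1, (u n y - u m y) ∂μ =
        (⨍ y in ball (0 : E) 1, u n y ∂μ) - ⨍ y in ball (0 : E) 1, u m y ∂μ :=
      setAverage_sub (integrableOn_ball_of_contDiff μ (hu n) 0 1) (integrableOn_ball_of_contDiff μ (hu m) 0 1)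
    have heq : w n - w m = fun x => (u n x - u m x) - ⨍ y in ball (0 : E) 1, (u n y - u m y) ∂μ := by
      funext x; simp only [Pi.sub_apply, hw, hav]; abel
    have hfd : fderiv ℝ (fun x => u n x - u m x) = fderiv ℝ (u n) - fderiv ℝ (u m) := by
      funext x
      exact fderiv_sub (((hu n).differentiable one_ne_zero) x) (((hu m).differentiable one_ne_zero) x)
    rw [heq]
    refine (hK _ hGd).trans ?_
    rw [hfd]
    gcongr
    have hsplit : fderiv ℝ (u n) - fderiv ℝ (u m) = (fderiv ℝ (u n) - G) - (fderiv ℝ (u m) - G) := by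
      abel
    rw [hsplit]
    exact eLpNorm_sub_le (hDm n) (hDm m) one_le_two
  -- (2) a fast subsequence and its a.e. limit
  obtain ⟨φ, -, hφ⟩ := exists_strictMono_le_half_pow hlim
  have hae : ∀ᵐ x ∂μ, ∃ l : F, Tendsto (fun k => w (φ k) x) atTop (𝓝 l) := by
    have hball : ∀ N : ℕ, ∀ᵐ x ∂μ.restrict (ball (0 : E) N),
        ∃ l : F, Tendsto (fun k => w (φ k) x) atTop (𝓝 l) := by
      intro N
      obtain ⟨K, hKt, hK⟩ := hcauchy N
      have h2t : (2 : ℝ≥0∞) * K + 1 ≠ ⊤ :=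
        ENNReal.add_ne_top.2 ⟨ENNReal.mul_ne_top (by norm_num) hKt, ENNReal.one_ne_top⟩
      refine MeasureTheory.Lp.ae_tendsto_of_cauchy_eLpNorm (p := 2) (fun k => hwm _ _) one_le_two
        (B := fun k => (2 * K + 1) * 2⁻¹ ^ k) ?_ ?_
      · rw [ENNReal.tsum_mul_left, ENNReal.tsum_geometric]
        refine ENNReal.mul_ne_top h2t (ENNReal.inv_ne_top.2 ?_)
        norm_num
      · intro N₀ k l hk hl
        have hpow : ∀ j, N₀ ≤ j → (2⁻¹ : ℝ≥0∞) ^ j ≤ 2⁻¹ ^ N₀ := fun j hj =>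
          pow_le_pow_right_of_le_one' (ENNReal.inv_le_one.2 one_le_two) hj
        have hne0 : (2⁻¹ : ℝ≥0∞) ^ N₀ ≠ 0 := (ENNReal.pow_pos (ENNReal.inv_pos.2 ENNReal.ofNat_ne_top) _).ne'
        have hnet : (2⁻¹ : ℝ≥0∞) ^ N₀ ≠ ⊤ := ENNReal.pow_ne_top (ENNReal.inv_ne_top.2 two_ne_zero)
        calc eLpNorm (w (φ k) - w (φ l)) 2 (μ.restrict (ball 0 N))
            ≤ K * (δ (φ k) + δ (φ l)) := hK _ _
          _ ≤ K * (2⁻¹ ^ N₀ + 2⁻¹ ^ N₀) := by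
              gcongr
              exacts [(hφ k).trans (hpow k hk), (hφ l).trans (hpow l hl)]
          _ = 2 * K * 2⁻¹ ^ N₀ := by ring
          _ < (2 * K + 1) * 2⁻¹ ^ N₀ := by
              rw [mul_comm (2 * K), mul_comm (2 * K + 1)]
              exact ENNReal.mul_lt_mul_right hne0 hnet
                (ENNReal.lt_add_right (ENNReal.mul_ne_top (by norm_num) hKt) one_ne_zero)
    have h' : ∀ᵐ x ∂μ.restrict (⋃ N : ℕ, ball (0 : E) N),
        ∃ l : F, Tendsto (fun k => w (φ k) x) atTop (𝓝 l) :=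
      (ae_restrict_iUnion_iff _ _).2 hball
    rwa [iUnion_ball_nat, Measure.restrict_univ] at h'
  set B : E → F := fun x => limUnder atTop (fun k => w (φ k) x) with hB
  have hBlim : ∀ᵐ x ∂μ, Tendsto (fun k => w (φ k) x) atTop (𝓝 (B x)) :=
    hae.mono fun x hx => tendsto_nhds_limUnder hx
  have hBm : AEStronglyMeasurable B μ :=
    aestronglyMeasurable_of_tendsto_ae atTop (fun k => hwm (φ k) μ) hBlim
  -- (3) full-sequence convergence on balls: `‖w n − B‖_{L²(B_R)} ≤ K_R δ n`
  have hconv : ∀ R : ℝ, ∃ K : ℝ≥0∞, K ≠ ⊤ ∧ ∀ n,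
      eLpNorm (w n - B) 2 (μ.restrict (ball 0 R)) ≤ K * δ n := by
    intro R
    obtain ⟨K, hKt, hK⟩ := hcauchy R
    refine ⟨K, hKt, fun n => ?_⟩
    have hlimk : ∀ᵐ x ∂μ.restrict (ball (0 : E) R),
        Tendsto (fun k => (w n - w (φ k)) x) atTop (𝓝 ((w n - B) x)) :=
      (ae_restrict_of_ae hBlim).mono fun x hx => by
        simpa only [Pi.sub_apply] using tendsto_const_nhds.sub hx
    have hF := MeasureTheory.Lp.eLpNorm_lim_le_liminf_eLpNorm (p := 2) (μ := μ.restrict (ball 0 R))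
      (fun k => (hwm n _).sub (hwm (φ k) _)) (w n - B) hlimk
    refine hF.trans ?_
    have hb : Tendsto (fun k => K * (δ n + 2⁻¹ ^ k)) atTop (𝓝 (K * δ n)) := by
      have h1 : Tendsto (fun k : ℕ => δ n + (2⁻¹ : ℝ≥0∞) ^ k) atTop (𝓝 (δ n + 0)) :=
        tendsto_const_nhds.add (ENNReal.tendsto_pow_atTop_nhds_zero_of_lt_one (by norm_num))
      rw [add_zero] at h1
      exact ENNReal.Tendsto.const_mul h1 (Or.inr hKt)
    calc liminf (fun k => eLpNorm (w n - w (φ k)) 2 (μ.restrict (ball 0 R))) atTop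
        ≤ liminf (fun k => K * (δ n + 2⁻¹ ^ k)) atTop := by
          refine liminf_le_liminf (Eventually.of_forall fun k => (hK n (φ k)).trans ?_)
          gcongr
          exact hφ k
      _ = K * δ n := hb.liminf_eq
  have htend : ∀ R : ℝ, Tendsto (fun n => eLpNorm (w n - B) 2 (μ.restrict (ball 0 R))) atTop (𝓝 0) := by
    intro R
    obtain ⟨K, hKt, hK⟩ := hconv R
    have h0 : Tendsto (fun n => K * δ n) atTop (𝓝 0) := by
      have := ENNReal.Tendsto.const_mul hlim (Or.inr hKt) (a := K)
      rwa [mul_zero] at this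
    exact tendsto_of_tendsto_of_tendsto_of_le_of_le tendsto_const_nhds h0 (fun _ => zero_le) hK
  -- (4) local integrability of `B` and of `G`
  obtain ⟨n₀, hn₀⟩ : ∃ n, δ n < ⊤ := by
    obtain ⟨N, hN⟩ := ENNReal.tendsto_atTop_zero.1 hlim 1 one_pos
    exact ⟨N, (hN N le_rfl).trans_lt ENNReal.one_lt_top⟩
  have hBint : ∀ R : ℝ, IntegrableOn B (ball (0 : E) R) μ := by
    intro R
    obtain ⟨K, hKt, hK⟩ := hconv R
    haveI : IsFiniteMeasure (μ.restrict (ball (0 : E) R)) :=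
      isFiniteMeasure_restrict.2 measure_ball_lt_top.ne
    have hdiff : MemLp (w n₀ - B) 2 (μ.restrict (ball 0 R)) :=
      ⟨(hwm n₀ _).sub hBm.restrict, (hK n₀).trans_lt (ENNReal.mul_lt_top hKt.lt_top hn₀)⟩
    have hwn : IntegrableOn (w n₀) (ball (0 : E) R) μ := integrableOn_ball_of_contDiff μ (hwC n₀) 0 R
    have h := hwn.sub (hdiff.integrable one_le_two)
    rw [sub_sub_cancel] at h
    exact h
  have hGint : ∀ R : ℝ, IntegrableOn G (ball (0 : E) R) μ := by
    intro R
    haveI : IsFiniteMeasure (μ.restrict (ball (0 : E) R)) :=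
      isFiniteMeasure_restrict.2 measure_ball_lt_top.ne
    have hdiff : MemLp (fderiv ℝ (u n₀) - G) 2 (μ.restrict (ball 0 R)) :=
      ⟨(hDm n₀).restrict, (eLpNorm_mono_measure _ Measure.restrict_le_self).trans_lt hn₀⟩
    have hDn : IntegrableOn (fderiv ℝ (u n₀)) (ball (0 : E) R) μ :=
      (((hu n₀).continuous_fderiv one_ne_zero).continuousOn.integrableOn_compact
        (isCompact_closedBall 0 R)).mono_set ball_subset_closedBall
    have h := hDn.sub (hdiff.integrable one_le_two)
    rw [sub_sub_cancel] at h
    exact h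
  have hBloc : LocallyIntegrable B μ := locallyIntegrable_of_integrableOn_ball hBint
  have hGloc : LocallyIntegrable G μ := locallyIntegrable_of_integrableOn_ball hGint
  -- (5) the weak-derivative identity
  refine ⟨B, ⟨hBloc.locallyIntegrableOn _, hGloc.locallyIntegrableOn _, fun ψ v hψ => ?_⟩, fun R => by
    simpa only [hw, Pi.sub_def] using htend R⟩
  have hψc : Continuous ψ := hψ.contDiff.continuous
  have hψ'c : Continuous fun x => fderiv ℝ ψ x v :=
    (hψ.contDiff.continuous_fderiv (by simp)).clm_apply continuous_const
  have hψ's : HasCompactSupport fun x => fderiv ℝ ψ x v := hψ.hasCompactSupport.fderiv_apply (𝕜 := ℝ) v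
  -- integration by parts for the `C¹` maps `w n`
  have hIBP : ∀ n, ∫ x, (fderiv ℝ ψ x v) • w n x ∂μ = -∫ x, ψ x • fderiv ℝ (u n) x v ∂μ := by
    intro n
    have h := (HasWeakFDerivOn.of_contDiff_holds (⟨univ, isOpen_univ⟩ : Opens E) μ (hwC n)).integral_fderiv_smul_eq
      ψ v hψ
    simp only [Opens.coe_mk, Measure.restrict_univ, hfdw n] at h
    exact h
  -- left pairing
  have hL : Tendsto (fun n => ∫ x, (fderiv ℝ ψ x v) • w n x ∂μ) atTop
      (𝓝 (∫ x, (fderiv ℝ ψ x v) • B x ∂μ)) :=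
    tendsto_integral_smul_of_tendsto_eLpNorm μ hψ'c hψ's (fun n => (hwC n).continuous.locallyIntegrable)
      hBloc htend
  -- right pairing: `x ↦ D(u n) x v → x ↦ G x v` in `L²` on every ball
  have hev : Continuous fun L : E →L[ℝ] F => L v := (ContinuousLinearMap.apply ℝ F v).continuous
  have hR : Tendsto (fun n => ∫ x, ψ x • fderiv ℝ (u n) x v ∂μ) atTop (𝓝 (∫ x, ψ x • G x v ∂μ)) := by
    refine tendsto_integral_smul_of_tendsto_eLpNorm μ hψc hψ.hasCompactSupport
      (fun n => (hev.comp ((hu n).continuous_fderiv one_ne_zero)).locallyIntegrable) ?_ ?_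
    · exact locallyIntegrable_of_integrableOn_ball fun R =>
        (ContinuousLinearMap.apply ℝ F v).integrable_comp (hGint R)
    · intro R
      have hle : ∀ n, eLpNorm ((fun x => fderiv ℝ (u n) x v) - fun x => G x v) 2 (μ.restrict (ball 0 R)) ≤
          ‖v‖₊ • δ n := by
        intro n
        refine (eLpNorm_mono_measure _ Measure.restrict_le_self).trans ?_
        refine eLpNorm_le_nnreal_smul_eLpNorm_of_ae_le_mul (Eventually.of_forall fun x => ?_) 2
        simp only [Pi.sub_apply]
        rw [← sub_apply, mul_comm]
        exact (fderiv ℝ (u n) x - G x).le_opNorm v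
      have h0 : Tendsto (fun n => ‖v‖₊ • δ n) atTop (𝓝 0) := by
        simp_rw [ENNReal.smul_def, smul_eq_mul]
        have := ENNReal.Tendsto.const_mul hlim (Or.inr ENNReal.coe_ne_top) (a := (‖v‖₊ : ℝ≥0∞))
        rwa [mul_zero] at this
      exact tendsto_of_tendsto_of_tendsto_of_le_of_le tendsto_const_nhds h0 (fun _ => zero_le) hle
  have hL' : Tendsto (fun n => ∫ x, (fderiv ℝ ψ x v) • w n x ∂μ) atTop (𝓝 (-∫ x, ψ x • G x v ∂μ)) := by
    simp_rw [hIBP]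
    exact hR.neg
  simp only [Opens.coe_mk, Measure.restrict_univ]
  exact tendsto_nhds_unique hL hL'

/-- **Variant with prescribed derivatives**: if `u n` has everywhere the Fréchet derivative `ω n x`
(`ω n` continuous) and `ω n → G` in `L²(μ)`, the conclusion of `exists_potential_of_tendsto_fderiv`
holds (this is the shape produced by the Poincaré lemma, Mathlib's
`Convex.exists_forall_hasFDerivAt_of_fderiv_symmetric`). [cite: Mazja1985, §1.1.13 Thm. 1] -/
theorem exists_potential_of_hasFDerivAt (u : ℕ → E → F) (ω : ℕ → E → E →L[ℝ] F)
    (hω : ∀ n, Continuous (ω n)) (hu : ∀ n x, HasFDerivAt (u n) (ω n x) x)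
    {G : E → E →L[ℝ] F} (hGm : AEStronglyMeasurable G μ)
    (hlim : Tendsto (fun n => eLpNorm (ω n - G) 2 μ) atTop (𝓝 0)) :
    ∃ B : E → F, HasWeakFDerivOn ⟨univ, isOpen_univ⟩ μ B G ∧
      ∀ R : ℝ, Tendsto (fun n => eLpNorm (fun x => u n x - (⨍ y in ball (0 : E) 1, u n y ∂μ) - B x) 2
        (μ.restrict (ball 0 R))) atTop (𝓝 0) := by
  have hfd : ∀ n, fderiv ℝ (u n) = ω n := fun n => funext fun x => (hu n x).fderiv
  have hC : ∀ n, ContDiff ℝ 1 (u n) := fun n => by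
    rw [contDiff_one_iff_fderiv]
    exact ⟨fun x => (hu n x).differentiableAt, by rw [hfd n]; exact hω n⟩
  exact exists_potential_of_tendsto_fderiv μ u hC hGm (by simpa only [hfd] using hlim)

end Summit.QuantumFields.YangMills.Theorems.PoincareLipschitzGradientLimitPotential

end
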